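import Literature.Analysis.OperatorTheory.RieszProjectionAnnulus
import Literature.Analysis.OperatorTheory.SimpleEigenvalueHolomorphic
import Literature.Analysis.Complex.BerahaKahaneWeissTwoLevel
import HarnessLib

/-!
# Two dominant simple eigenvalues of a holomorphic family: `T(ϰ)ⁿ = λ₀(ϰ)ⁿ Π₀(ϰ) + λ₁(ϰ)ⁿ Π₁(ϰ) + O(ρⁿ)`
  uniformly in `ϰ`, and Beraha–Kahane–Weiss zeros of `ϰ ↦ ⟨w(ϰ), T(ϰ)ⁿ v(ϰ)⟩`

Analysis/OperatorTheory proofs-layer file (theorems only, no definitions, no named facts),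
continuing `SimpleEigenvalueHolomorphic.lean` (ONE dominant simple eigenvalue:
`exists_dominant_eigenvalue_asymptotics`), `RieszProjectionAnnulus.lean` (annulus projections
`P_{s₁} − P_{s₀}` for concentric circles about a centre `c`) and
`Literature/Analysis/Complex/BerahaKahaneWeissTwoLevel.lean` (the two-level zero lemma with
amplitudes, `exists_zero_of_two_dominant_eigenvalues`). Kato VII-§1.3, Thm. 1.8 reduces a finite
system of eigenvalues of a holomorphic family `T(ϰ) ∈ 𝓑(X)` to Ch. II; for TWO simple eigenvalues
separated from each other and from the rest of the spectrum by two concentric circles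
`C(c, s₀) ⊂ C(c, s₁)` (rest inside `C(c, s₀)`, `λ₀(ϰ₀)` in the annulus, `λ₁(ϰ₀)` outside `C(c,s₁)`;
two points of equal modulus `≠` and a disc of smaller radius about `0` can always be separated this
way by moving the centre slightly off the origin) we prove:

* **`exists_two_dominant_eigenvalues_asymptotics`** — on a ball around `ϰ₀`: both circles stay in
  `ρ(T(ϰ))`, the annulus projection `Π₀(ϰ) = P_{s₁}[T(ϰ)] − P_{s₀}[T(ϰ)]` and the outer projection
  `Π₁(ϰ) = 1 − P_{s₁}[T(ϰ)]` keep rank one and are holomorphic, `T(ϰ) Π_j(ϰ) = λ_j(ϰ) Π_j(ϰ)` with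
  `λ_j` holomorphic (Kato II-(2.5)–(2.7) for `m = 1`, twice), and for all `n`
  `T(ϰ)ⁿ = λ₀(ϰ)ⁿ Π₀(ϰ) + λ₁(ϰ)ⁿ Π₁(ϰ) + T(ϰ)ⁿ P_{s₀}[T(ϰ)]`, `‖T(ϰ)ⁿ P_{s₀}[T(ϰ)]‖ ≤ M (‖c‖ + s₀)ⁿ`
  (Kato III-(6.19)/(6.25) with the uniform resolvent bound of VII Thm. 1.7's proof);
* **`exists_twoLevel_expansion`** — for holomorphic vector data `v(ϰ) ∈ X`, `w(ϰ) ∈ X*` the scalar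
  sequence `Z_n(ϰ) = ⟨w(ϰ), T(ϰ)ⁿ v(ϰ)⟩` satisfies
  `‖Z_n(ϰ) − c₀(ϰ) λ₀(ϰ)ⁿ − c₁(ϰ) λ₁(ϰ)ⁿ‖ ≤ C (‖c‖ + s₀)ⁿ` uniformly on the ball, with the
  holomorphic AMPLITUDES `c_j(ϰ) = ⟨w(ϰ), Π_j(ϰ) v(ϰ)⟩` — exactly the input format of the two-level
  zero lemma;
* **`exists_zero_of_tied_dominant_eigenvalues`** — if at `ϰ₀` the two eigenvalues TIE in modulus
  (`‖μ₀‖ = ‖μ₁‖ > ‖c‖ + s₀`, eigenvectors given), the amplitudes do not vanish at `ϰ₀` and the ratio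
  of the branches is not locally constant, then `Z_n` has a zero in every neighbourhood of `ϰ₀` for
  all large `n`: the transfer-operator form of the Beraha–Kahane–Weiss theorem (zeros of
  `tr`/matrix elements of `T(ϰ)ⁿ` accumulate on the equimodular locus of the two dominant
  eigenvalues), as used for partition-function zeros of transfer matrices.

## Mathlib / tree search

Tree: `exists_ball_differentiableOn_rieszProjection_comp`, `eventually_norm_resolvent_comp_le`,
`continuousAt_rieszProjection`, `PairOfProjections.finrank_range_eq`,
`exists_differentiableOn_eigenvalue`, `pow_mul_eq_pow_smul`, the annulus algebra of
`RieszProjectionAnnulus.lean`, `Literature.Analysis.Complex.exists_zero_of_two_dominant_eigenvalues`.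
Searched `two.*dominant.*eigenvalue`, `exists_dominant_eigenvalues` — only the one-eigenvalue file.

## References

* T. Kato, *Perturbation Theory for Linear Operators*, Springer 1966, VII-§1.3 Thm. 1.7–1.8,
  II-§2.1 (2.5)–(2.7), III-§6.4 Thm. 6.17 (6.19)–(6.26), III-§6.5 (held copy
  `book:kato1966-perturbation-theory-linear-operators`, chunks p0108, p0221, p0429–p0431). [Kato1966]
* S. Beraha, J. Kahane, N. J. Weiss, *Limits of zeroes of recursively defined polynomials*,
  Proc. Nat. Acad. Sci. USA 72 (1975), 4209; and in *Studies in Foundations and Combinatorics*,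
  Adv. Math. Suppl. Stud. 1 (1978), 213–232, Theorem (non-degenerate two-term case). [BerahaKahaneWeiss1975]
-/

noncomputable section

open Complex MeasureTheory Metric Set Filter Topology

namespace Literature.Analysis.OperatorTheory

/-! ### Geometry: separating two equimodular points and a smaller disc by concentric circles -/

/-- **Two distinct points of equal modulus `ρ` and the closed disc `|z| ≤ r`, `r < ρ`, are
separated by two concentric circles about a centre slightly off the origin**: there are `c` and
`0 < s₀ < s₁` with `closedBall 0 r ⊆ ball c s₀`, `μ₀` in the open annulus `s₀ < |z − c| < s₁`,
`μ₁` outside `closedBall c s₁`, and `‖c‖ + s₀ < ρ` (so the inner part still decays faster than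
`ρⁿ`). Take `c = −t μ₁`, `t = (ρ − r)/(4ρ)`: then `|μ₁ − c| = (1 + t)ρ` while
`|μ₀ − c| < (1 + t)ρ` strictly because `μ₀ ≠ μ₁` (strict convexity of `ℂ`). This is how a
modulus tie `|μ₀| = |μ₁|` of two dominant eigenvalues is put in the position required by
`exists_two_dominant_eigenvalues_asymptotics`. [folklore] -/
theorem exists_center_separating_of_norm_eq {μ₀ μ₁ : ℂ} {r : ℝ} (hr : 0 ≤ r)
    (hμ : ‖μ₁‖ = ‖μ₀‖) (hne : μ₀ ≠ μ₁) (hrμ : r < ‖μ₀‖) :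
    ∃ (c : ℂ) (s₀ s₁ : ℝ), 0 < s₀ ∧ s₀ < s₁ ∧ closedBall (0 : ℂ) r ⊆ ball c s₀ ∧
      μ₀ ∉ closedBall c s₀ ∧ μ₀ ∈ ball c s₁ ∧ μ₁ ∉ closedBall c s₁ ∧ ‖c‖ + s₀ < ‖μ₀‖ := by
  set ρ : ℝ := ‖μ₀‖ with hρ
  have hρpos : 0 < ρ := hr.trans_lt hrμ
  set t : ℝ := (ρ - r) / (4 * ρ) with ht
  have htpos : 0 < t := div_pos (by linarith) (by linarith)
  have htρ : t * ρ = (ρ - r) / 4 := by rw [ht]; field_simp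
  set c : ℂ := -((t : ℂ) * μ₁) with hc
  have hnc : ‖c‖ = t * ρ := by
    rw [hc, norm_neg, norm_mul, Complex.norm_real, Real.norm_eq_abs, abs_of_pos htpos, hμ]
  -- `|μ₁ − c| = (1 + t) ρ`
  have h1c : dist μ₁ c = (1 + t) * ρ := by
    rw [dist_eq_norm, hc, sub_neg_eq_add,
      show μ₁ + (t : ℂ) * μ₁ = ((1 + t : ℝ) : ℂ) * μ₁ by push_cast; ring, norm_mul,
      Complex.norm_real, Real.norm_eq_abs, abs_of_pos (by linarith), hμ]
  -- `|μ₀ − c| < (1 + t) ρ` (strict convexity: `μ₀ ≠ μ₁` of equal norm are not on one ray)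
  have hinner : inner ℝ μ₀ μ₁ < ρ ^ 2 := by
    have hsub : 0 < ‖μ₀ - μ₁‖ := norm_pos_iff.2 (sub_ne_zero.2 hne)
    have hsq : ‖μ₀ - μ₁‖ ^ 2 = ‖μ₀‖ ^ 2 - 2 * inner ℝ μ₀ μ₁ + ‖μ₁‖ ^ 2 :=
      norm_sub_sq_real μ₀ μ₁
    rw [hμ] at hsq
    nlinarith [sq_nonneg ‖μ₀ - μ₁‖, hsub]
  have h0c : dist μ₀ c < (1 + t) * ρ := by
    rw [dist_eq_norm, hc, sub_neg_eq_add]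
    have hsq : ‖μ₀ + (t : ℂ) * μ₁‖ ^ 2 = ‖μ₀‖ ^ 2 + 2 * inner ℝ μ₀ ((t : ℂ) * μ₁) +
        ‖(t : ℂ) * μ₁‖ ^ 2 := norm_add_sq_real μ₀ ((t : ℂ) * μ₁)
    have hin : inner ℝ μ₀ ((t : ℂ) * μ₁) = t * inner ℝ μ₀ μ₁ := by
      rw [show (t : ℂ) * μ₁ = (t : ℝ) • μ₁ by rw [Complex.real_smul], real_inner_smul_right]
    have hnt : ‖(t : ℂ) * μ₁‖ = t * ρ := by
      rw [norm_mul, Complex.norm_real, Real.norm_eq_abs, abs_of_pos htpos, hμ]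
    rw [hin, hnt] at hsq
    have hlt : ‖μ₀ + (t : ℂ) * μ₁‖ ^ 2 < ((1 + t) * ρ) ^ 2 := by
      rw [hsq]; nlinarith [hinner, htpos]
    exact lt_of_pow_lt_pow_left₀ 2 (by positivity) hlt
  -- `|μ₀ − c| ≥ ρ − tρ = (3ρ + r)/4`
  have h0c' : (3 * ρ + r) / 4 ≤ dist μ₀ c := by
    rw [dist_eq_norm, hc, sub_neg_eq_add]
    have h := norm_sub_norm_le μ₀ (-((t : ℂ) * μ₁))
    rw [sub_neg_eq_add, norm_neg, norm_mul, Complex.norm_real, Real.norm_eq_abs, abs_of_pos htpos,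
      hμ] at h
    linarith
  refine ⟨c, (ρ + r) / 2, (dist μ₀ c + (1 + t) * ρ) / 2, by linarith, by linarith,
    fun z hz => ?_, fun h => ?_, ?_, fun h => ?_, ?_⟩
  · -- `closedBall 0 r ⊆ ball c s₀`
    rw [mem_closedBall, dist_zero_right] at hz
    rw [mem_ball]
    calc dist z c ≤ ‖z‖ + ‖c‖ := by rw [dist_eq_norm]; exact norm_sub_le _ _
      _ ≤ r + t * ρ := by rw [hnc]; linarith
      _ < (ρ + r) / 2 := by linarith
  · rw [mem_closedBall] at h; linarith
  · rw [mem_ball]; linarith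
  · rw [mem_closedBall, h1c] at h; linarith
  · rw [hnc]; linarith

section Operator

variable {E : Type*} [NormedAddCommGroup E] [NormedSpace ℂ E] [CompleteSpace E]

/-! ### Two dominant simple eigenvalues: the uniform two-term expansion of the powers -/

/-- **Two-term expansion of the powers of a holomorphic family with two simple eigenvalues beyond
the circle `|z − c| = s₀`, separated by the circle `|z − c| = s₁`.** Let `T` be holomorphic on an
open `U ∋ ϰ₀`, let `0 < s₀ < s₁` and both circles `C(c, s₀)`, `C(c, s₁)` lie in `ρ(T(ϰ₀))`, and let
the annulus projection `P_{s₁} − P_{s₀}` and the outer projection `1 − P_{s₁}` of `T(ϰ₀)` both have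
rank one. Then there are `ε > 0`, `M` and `λ₀, λ₁` holomorphic on `ball ϰ₀ ε ⊆ U` such that for
every `ϰ` in the ball: both circles lie in `ρ(T(ϰ))`, both projections keep rank one,
`T(ϰ) Π₀(ϰ) = λ₀(ϰ) Π₀(ϰ)`, `T(ϰ) Π₁(ϰ) = λ₁(ϰ) Π₁(ϰ)` (`Π₀ = P_{s₁} − P_{s₀}`, `Π₁ = 1 − P_{s₁}`,
both holomorphic in `ϰ`), and for all `n`
`T(ϰ)ⁿ = λ₀(ϰ)ⁿ Π₀(ϰ) + λ₁(ϰ)ⁿ Π₁(ϰ) + T(ϰ)ⁿ P_{s₀}[T(ϰ)]` with `‖T(ϰ)ⁿ P_{s₀}[T(ϰ)]‖ ≤ M (‖c‖ + s₀)ⁿ`.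
[cite: Kato1966, VII-§1.3 Thm. 1.8 and III-§6.4 Thm. 6.17 (6.19)–(6.26)] -/
theorem exists_two_dominant_eigenvalues_asymptotics {T : ℂ → E →L[ℂ] E} {U : Set ℂ}
    (hU : IsOpen U) (hT : DifferentiableOn ℂ T U) {a₀ : ℂ} (ha₀ : a₀ ∈ U) {c : ℂ} {s₀ s₁ : ℝ}
    (hs₀ : 0 < s₀) (h01 : s₀ < s₁) (hS₀ : sphere c s₀ ⊆ resolventSet ℂ (T a₀))
    (hS₁ : sphere c s₁ ⊆ resolventSet ℂ (T a₀))
    (h0 : Module.finrank ℂ (LinearMap.range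
      ((rieszProjection (T a₀) c s₁ - rieszProjection (T a₀) c s₀ : E →L[ℂ] E) : E →ₗ[ℂ] E)) = 1)
    (h1 : Module.finrank ℂ (LinearMap.range
      ((1 - rieszProjection (T a₀) c s₁ : E →L[ℂ] E) : E →ₗ[ℂ] E)) = 1) :
    ∃ ε : ℝ, 0 < ε ∧ ball a₀ ε ⊆ U ∧ ∃ (lam₀ lam₁ : ℂ → ℂ) (M : ℝ), 0 ≤ M ∧
      DifferentiableOn ℂ lam₀ (ball a₀ ε) ∧ DifferentiableOn ℂ lam₁ (ball a₀ ε) ∧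
      DifferentiableOn ℂ (fun a => rieszProjection (T a) c s₀) (ball a₀ ε) ∧
      DifferentiableOn ℂ (fun a => rieszProjection (T a) c s₁) (ball a₀ ε) ∧
      ∀ a ∈ ball a₀ ε, sphere c s₀ ⊆ resolventSet ℂ (T a) ∧ sphere c s₁ ⊆ resolventSet ℂ (T a) ∧
        Module.finrank ℂ (LinearMap.range
          ((rieszProjection (T a) c s₁ - rieszProjection (T a) c s₀ : E →L[ℂ] E) : E →ₗ[ℂ] E)) = 1 ∧
        Module.finrank ℂ (LinearMap.range
          ((1 - rieszProjection (T a) c s₁ : E →L[ℂ] E) : E →ₗ[ℂ] E)) = 1 ∧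
        T a * (rieszProjection (T a) c s₁ - rieszProjection (T a) c s₀) =
          lam₀ a • (rieszProjection (T a) c s₁ - rieszProjection (T a) c s₀) ∧
        T a * (1 - rieszProjection (T a) c s₁) = lam₁ a • (1 - rieszProjection (T a) c s₁) ∧
        (∀ n : ℕ, T a ^ n =
          lam₀ a ^ n • (rieszProjection (T a) c s₁ - rieszProjection (T a) c s₀) +
            lam₁ a ^ n • (1 - rieszProjection (T a) c s₁) + T a ^ n * rieszProjection (T a) c s₀) ∧
        ∀ n : ℕ, ‖T a ^ n * rieszProjection (T a) c s₀‖ ≤ M * (‖c‖ + s₀) ^ n := by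
  have hs₁ : 0 < s₁ := hs₀.trans h01
  have hTc : ContinuousAt T a₀ := (hT.differentiableAt (hU.mem_nhds ha₀)).continuousAt
  -- (1) both circles stay in the resolvent set and both Riesz projections are holomorphic
  obtain ⟨ε₀, hε₀, hball₀U, hres₀, hdiff₀⟩ :=
    exists_ball_differentiableOn_rieszProjection_comp hU hT ha₀ hs₀.le hS₀
  obtain ⟨ε₁, hε₁, -, hres₁, hdiff₁⟩ :=
    exists_ball_differentiableOn_rieszProjection_comp hU hT ha₀ hs₁.le hS₁
  -- (2) uniform resolvent bound on the inner circle
  obtain ⟨M₀, hM₀, hbound⟩ := eventually_norm_resolvent_comp_le hTc (isCompact_sphere c s₀) hS₀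
  -- (3) both projections stay within distance `< 1/2` of their values at `a₀`
  have hclose₀ : ∀ᶠ a in 𝓝 a₀,
      dist (rieszProjection (T a) c s₀) (rieszProjection (T a₀) c s₀) < 1 / 2 :=
    (ContinuousAt.comp (continuousAt_rieszProjection hs₀.le hS₀) hTc).eventually
      (ball_mem_nhds _ (by norm_num))
  have hclose₁ : ∀ᶠ a in 𝓝 a₀,
      dist (rieszProjection (T a) c s₁) (rieszProjection (T a₀) c s₁) < 1 / 2 :=
    (ContinuousAt.comp (continuousAt_rieszProjection hs₁.le hS₁) hTc).eventually
      (ball_mem_nhds _ (by norm_num))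
  obtain ⟨ε₂, hε₂, hball₂⟩ := Metric.eventually_nhds_iff_ball.1 (hbound.and (hclose₀.and hclose₁))
  set ε := min (min ε₀ ε₁) ε₂ with hε
  have hεpos : 0 < ε := lt_min (lt_min hε₀ hε₁) hε₂
  have hb₀ : ball a₀ ε ⊆ ball a₀ ε₀ :=
    ball_subset_ball ((min_le_left _ _).trans (min_le_left _ _))
  have hb₁ : ball a₀ ε ⊆ ball a₀ ε₁ :=
    ball_subset_ball ((min_le_left _ _).trans (min_le_right _ _))
  have hb₂ : ball a₀ ε ⊆ ball a₀ ε₂ := ball_subset_ball (min_le_right _ _)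
  have hres₀' : ∀ a ∈ ball a₀ ε, sphere c s₀ ⊆ resolventSet ℂ (T a) := fun a ha => hres₀ a (hb₀ ha)
  have hres₁' : ∀ a ∈ ball a₀ ε, sphere c s₁ ⊆ resolventSet ℂ (T a) := fun a ha => hres₁ a (hb₁ ha)
  -- idempotency of the annulus projection `Q` and of the outer projection `R`
  have hQQ : ∀ a ∈ ball a₀ ε,
      (rieszProjection (T a) c s₁ - rieszProjection (T a) c s₀) *
        (rieszProjection (T a) c s₁ - rieszProjection (T a) c s₀) =
      rieszProjection (T a) c s₁ - rieszProjection (T a) c s₀ := fun a ha =>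
    sub_rieszProjection_mul_self hs₀ h01.le (hres₀' a ha) (hres₁' a ha)
  have hQQ₀ : (rieszProjection (T a₀) c s₁ - rieszProjection (T a₀) c s₀) *
        (rieszProjection (T a₀) c s₁ - rieszProjection (T a₀) c s₀) =
      rieszProjection (T a₀) c s₁ - rieszProjection (T a₀) c s₀ :=
    sub_rieszProjection_mul_self hs₀ h01.le hS₀ hS₁
  have hRR : ∀ a ∈ ball a₀ ε, (1 - rieszProjection (T a) c s₁) * (1 - rieszProjection (T a) c s₁) =
      1 - rieszProjection (T a) c s₁ := fun a ha =>
    one_sub_rieszProjection_mul_self hs₁ (hres₁' a ha)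
  have hRR₀ : (1 - rieszProjection (T a₀) c s₁) * (1 - rieszProjection (T a₀) c s₁) =
      1 - rieszProjection (T a₀) c s₁ := one_sub_rieszProjection_mul_self hs₁ hS₁
  -- rank persistence
  have hrankQ : ∀ a ∈ ball a₀ ε, Module.finrank ℂ (LinearMap.range
      ((rieszProjection (T a) c s₁ - rieszProjection (T a) c s₀ : E →L[ℂ] E) : E →ₗ[ℂ] E)) = 1 := by
    intro a ha
    have h₀ := (hball₂ a (hb₂ ha)).2.1
    have h₁ := (hball₂ a (hb₂ ha)).2.2
    rw [dist_eq_norm] at h₀ h₁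
    have hd : ‖(rieszProjection (T a) c s₁ - rieszProjection (T a) c s₀) -
        (rieszProjection (T a₀) c s₁ - rieszProjection (T a₀) c s₀)‖ < 1 := by
      rw [show (rieszProjection (T a) c s₁ - rieszProjection (T a) c s₀) -
          (rieszProjection (T a₀) c s₁ - rieszProjection (T a₀) c s₀) =
          (rieszProjection (T a) c s₁ - rieszProjection (T a₀) c s₁) -
            (rieszProjection (T a) c s₀ - rieszProjection (T a₀) c s₀) by abel]
      calc _ ≤ ‖rieszProjection (T a) c s₁ - rieszProjection (T a₀) c s₁‖ +
            ‖rieszProjection (T a) c s₀ - rieszProjection (T a₀) c s₀‖ := norm_sub_le _ _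
        _ < 1 / 2 + 1 / 2 := add_lt_add h₁ h₀
        _ = 1 := by norm_num
    rw [PairOfProjections.finrank_range_eq (hQQ a ha) hQQ₀ hd, h0]
  have hrankR : ∀ a ∈ ball a₀ ε, Module.finrank ℂ (LinearMap.range
      ((1 - rieszProjection (T a) c s₁ : E →L[ℂ] E) : E →ₗ[ℂ] E)) = 1 := by
    intro a ha
    have h₁ := (hball₂ a (hb₂ ha)).2.2
    rw [dist_eq_norm] at h₁
    have hd : ‖(1 - rieszProjection (T a) c s₁) - (1 - rieszProjection (T a₀) c s₁)‖ < 1 := by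
      rw [sub_sub_sub_cancel_left, norm_sub_rev]
      linarith
    rw [PairOfProjections.finrank_range_eq (hRR a ha) hRR₀ hd, h1]
  -- holomorphy of `Q` and `R` and the two eigenvalue branches
  have hdiff₀' : DifferentiableOn ℂ (fun a => rieszProjection (T a) c s₀) (ball a₀ ε) :=
    hdiff₀.mono hb₀
  have hdiff₁' : DifferentiableOn ℂ (fun a => rieszProjection (T a) c s₁) (ball a₀ ε) :=
    hdiff₁.mono hb₁
  have hdiffQ : DifferentiableOn ℂ
      (fun a => rieszProjection (T a) c s₁ - rieszProjection (T a) c s₀) (ball a₀ ε) :=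
    hdiff₁'.sub hdiff₀'
  have hdiffR : DifferentiableOn ℂ (fun a => 1 - rieszProjection (T a) c s₁) (ball a₀ ε) :=
    (differentiableOn_const (1 : E →L[ℂ] E)).sub hdiff₁'
  have hTU : DifferentiableOn ℂ T (ball a₀ ε) := hT.mono (hb₀.trans hball₀U)
  obtain ⟨lam₀, hlam₀d, hlam₀⟩ := exists_differentiableOn_eigenvalue
    (P := fun a => rieszProjection (T a) c s₁ - rieszProjection (T a) c s₀) isOpen_ball hTU
    hdiffQ hrankQ
    (fun a ha => commute_sub_rieszProjection hs₀.le hs₁.le (hres₀' a ha) (hres₁' a ha))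
  obtain ⟨lam₁, hlam₁d, hlam₁⟩ := exists_differentiableOn_eigenvalue
    (P := fun a => 1 - rieszProjection (T a) c s₁) isOpen_ball hTU hdiffR hrankR
    (fun a ha => commute_one_sub_rieszProjection hs₁.le (hres₁' a ha))
  refine ⟨ε, hεpos, hb₀.trans hball₀U, lam₀, lam₁, s₀ * M₀, by positivity, hlam₀d, hlam₁d,
    hdiff₀', hdiff₁', fun a ha => ⟨hres₀' a ha, hres₁' a ha, hrankQ a ha, hrankR a ha,
    hlam₀ a ha, hlam₁ a ha, fun n => ?_, fun n => ?_⟩⟩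
  · -- `Tⁿ = λ₀ⁿ Q + λ₁ⁿ R + Tⁿ P₀`
    calc T a ^ n = T a ^ n * (rieszProjection (T a) c s₀ +
          (rieszProjection (T a) c s₁ - rieszProjection (T a) c s₀) +
          (1 - rieszProjection (T a) c s₁)) := by
          rw [rieszProjection_add_sub_add_one_sub, mul_one]
      _ = T a ^ n * rieszProjection (T a) c s₀ +
            T a ^ n * (rieszProjection (T a) c s₁ - rieszProjection (T a) c s₀) +
            T a ^ n * (1 - rieszProjection (T a) c s₁) := by rw [mul_add, mul_add]
      _ = _ := by
          rw [pow_mul_eq_pow_smul (hlam₀ a ha) n, pow_mul_eq_pow_smul (hlam₁ a ha) n]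
          abel
  · -- `‖Tⁿ P_{s₀}‖ ≤ s₀ M₀ (‖c‖ + s₀)ⁿ`
    exact norm_pow_mul_rieszProjection_le_of_center hs₀ (hres₀' a ha) (hball₂ a (hb₂ ha)).1 n

/-! ### The scalar two-level expansion with amplitudes -/

/-- **Two-level expansion of matrix elements.** In the situation of
`exists_two_dominant_eigenvalues_asymptotics`, for vector data `v(ϰ) ∈ X` and `w(ϰ) ∈ X*`
holomorphic on `U`, the scalars `Z_n(ϰ) = ⟨w(ϰ), T(ϰ)ⁿ v(ϰ)⟩` satisfy, uniformly on a ball around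
`ϰ₀`, `‖Z_n(ϰ) − c₀(ϰ) λ₀(ϰ)ⁿ − c₁(ϰ) λ₁(ϰ)ⁿ‖ ≤ C (‖c‖ + s₀)ⁿ` with the holomorphic amplitudes
`c₀(ϰ) = ⟨w(ϰ), Π₀(ϰ) v(ϰ)⟩`, `c₁(ϰ) = ⟨w(ϰ), Π₁(ϰ) v(ϰ)⟩` and the holomorphic branches
`T(ϰ) Π_j(ϰ) = λ_j(ϰ) Π_j(ϰ)` — the input of the Beraha–Kahane–Weiss two-level zero lemma
(`Literature.Analysis.Complex.exists_zero_of_two_dominant_eigenvalues`).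
[cite: Kato1966, VII-§1.3 Thm. 1.8 and III-§6.4 Thm. 6.17 (6.19)–(6.26)] -/
theorem exists_twoLevel_expansion {T : ℂ → E →L[ℂ] E} {U : Set ℂ}
    (hU : IsOpen U) (hT : DifferentiableOn ℂ T U) {a₀ : ℂ} (ha₀ : a₀ ∈ U) {c : ℂ} {s₀ s₁ : ℝ}
    (hs₀ : 0 < s₀) (h01 : s₀ < s₁) (hS₀ : sphere c s₀ ⊆ resolventSet ℂ (T a₀))
    (hS₁ : sphere c s₁ ⊆ resolventSet ℂ (T a₀))
    (h0 : Module.finrank ℂ (LinearMap.range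
      ((rieszProjection (T a₀) c s₁ - rieszProjection (T a₀) c s₀ : E →L[ℂ] E) : E →ₗ[ℂ] E)) = 1)
    (h1 : Module.finrank ℂ (LinearMap.range
      ((1 - rieszProjection (T a₀) c s₁ : E →L[ℂ] E) : E →ₗ[ℂ] E)) = 1)
    {w : ℂ → E →L[ℂ] ℂ} {v : ℂ → E} (hw : DifferentiableOn ℂ w U) (hv : DifferentiableOn ℂ v U) :
    ∃ ε : ℝ, 0 < ε ∧ ball a₀ ε ⊆ U ∧ ∃ (lam₀ lam₁ c₀ c₁ : ℂ → ℂ) (C : ℝ), 0 ≤ C ∧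
      DifferentiableOn ℂ lam₀ (ball a₀ ε) ∧ DifferentiableOn ℂ lam₁ (ball a₀ ε) ∧
      DifferentiableOn ℂ c₀ (ball a₀ ε) ∧ DifferentiableOn ℂ c₁ (ball a₀ ε) ∧
      (∀ a ∈ ball a₀ ε, sphere c s₀ ⊆ resolventSet ℂ (T a) ∧ sphere c s₁ ⊆ resolventSet ℂ (T a) ∧
        T a * (rieszProjection (T a) c s₁ - rieszProjection (T a) c s₀) =
          lam₀ a • (rieszProjection (T a) c s₁ - rieszProjection (T a) c s₀) ∧
        T a * (1 - rieszProjection (T a) c s₁) = lam₁ a • (1 - rieszProjection (T a) c s₁) ∧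
        c₀ a = w a ((rieszProjection (T a) c s₁ - rieszProjection (T a) c s₀) (v a)) ∧
        c₁ a = w a ((1 - rieszProjection (T a) c s₁) (v a))) ∧
      ∀ a ∈ ball a₀ ε, ∀ n : ℕ,
        ‖w a ((T a ^ n) (v a)) - c₀ a * lam₀ a ^ n - c₁ a * lam₁ a ^ n‖ ≤ C * (‖c‖ + s₀) ^ n := by
  obtain ⟨ε₁, hε₁, hballU, lam₀, lam₁, M, hM, hlam₀d, hlam₁d, hdiff₀, hdiff₁, hall⟩ :=
    exists_two_dominant_eigenvalues_asymptotics hU hT ha₀ hs₀ h01 hS₀ hS₁ h0 h1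
  -- local bounds for `‖w a‖` and `‖v a‖`
  have hUn : U ∈ 𝓝 a₀ := hU.mem_nhds ha₀
  have hwc : ContinuousAt w a₀ := (hw.differentiableAt hUn).continuousAt
  have hvc : ContinuousAt v a₀ := (hv.differentiableAt hUn).continuousAt
  have hwb : ∀ᶠ a in 𝓝 a₀, ‖w a‖ < ‖w a₀‖ + 1 := by
    have h := hwc.norm
    exact h.eventually (Iio_mem_nhds (lt_add_one _))
  have hvb : ∀ᶠ a in 𝓝 a₀, ‖v a‖ < ‖v a₀‖ + 1 := by
    have h := hvc.norm
    exact h.eventually (Iio_mem_nhds (lt_add_one _))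
  obtain ⟨ε₂, hε₂, hball₂⟩ := Metric.eventually_nhds_iff_ball.1 (hwb.and hvb)
  set ε := min ε₁ ε₂ with hε
  have hεpos : 0 < ε := lt_min hε₁ hε₂
  have hb₁ : ball a₀ ε ⊆ ball a₀ ε₁ := ball_subset_ball (min_le_left _ _)
  have hb₂ : ball a₀ ε ⊆ ball a₀ ε₂ := ball_subset_ball (min_le_right _ _)
  -- the amplitudes
  set c₀ : ℂ → ℂ := fun a => w a ((rieszProjection (T a) c s₁ - rieszProjection (T a) c s₀) (v a))
    with hc₀
  set c₁ : ℂ → ℂ := fun a => w a ((1 - rieszProjection (T a) c s₁) (v a)) with hc₁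
  have hwU : DifferentiableOn ℂ w (ball a₀ ε) := hw.mono (hb₁.trans hballU)
  have hvU : DifferentiableOn ℂ v (ball a₀ ε) := hv.mono (hb₁.trans hballU)
  have hc₀d : DifferentiableOn ℂ c₀ (ball a₀ ε) :=
    hwU.clm_apply (((hdiff₁.mono hb₁).sub (hdiff₀.mono hb₁)).clm_apply hvU)
  have hc₁d : DifferentiableOn ℂ c₁ (ball a₀ ε) :=
    hwU.clm_apply (((differentiableOn_const (1 : E →L[ℂ] E)).sub (hdiff₁.mono hb₁)).clm_apply hvU)
  set C : ℝ := (‖w a₀‖ + 1) * M * (‖v a₀‖ + 1) with hC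
  have hC0 : 0 ≤ C := by positivity
  refine ⟨ε, hεpos, hb₁.trans hballU, lam₀, lam₁, c₀, c₁, C, hC0, hlam₀d.mono hb₁, hlam₁d.mono hb₁,
    hc₀d, hc₁d, fun a ha => ?_, fun a ha n => ?_⟩
  · obtain ⟨hr₀, hr₁, -, -, hl₀, hl₁, -, -⟩ := hall a (hb₁ ha)
    exact ⟨hr₀, hr₁, hl₀, hl₁, rfl, rfl⟩
  · obtain ⟨-, -, -, -, -, -, hdec, hbd⟩ := hall a (hb₁ ha)
    have hwa : ‖w a‖ < ‖w a₀‖ + 1 := (hball₂ a (hb₂ ha)).1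
    have hva : ‖v a‖ < ‖v a₀‖ + 1 := (hball₂ a (hb₂ ha)).2
    have key : w a ((T a ^ n) (v a)) = c₀ a * lam₀ a ^ n + c₁ a * lam₁ a ^ n +
        w a ((T a ^ n * rieszProjection (T a) c s₀) (v a)) := by
      conv_lhs => rw [hdec n]
      simp only [hc₀, hc₁, add_apply, smul_apply, map_add, map_smul, smul_eq_mul]
      ring
    have key2 : w a ((T a ^ n) (v a)) - c₀ a * lam₀ a ^ n - c₁ a * lam₁ a ^ n =
        w a ((T a ^ n * rieszProjection (T a) c s₀) (v a)) := by
      rw [key]; ring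
    rw [key2]
    calc ‖w a ((T a ^ n * rieszProjection (T a) c s₀) (v a))‖
        ≤ ‖w a‖ * ‖(T a ^ n * rieszProjection (T a) c s₀) (v a)‖ := (w a).le_opNorm _
      _ ≤ ‖w a‖ * (‖T a ^ n * rieszProjection (T a) c s₀‖ * ‖v a‖) := by
          gcongr; exact (T a ^ n * rieszProjection (T a) c s₀).le_opNorm _
      _ ≤ (‖w a₀‖ + 1) * (M * (‖c‖ + s₀) ^ n * (‖v a₀‖ + 1)) := by
          have h1 : ‖T a ^ n * rieszProjection (T a) c s₀‖ * ‖v a‖ ≤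
              M * (‖c‖ + s₀) ^ n * (‖v a₀‖ + 1) :=
            mul_le_mul (hbd n) hva.le (norm_nonneg _) (by positivity)
          exact mul_le_mul hwa.le h1 (by positivity) (by positivity)
      _ = C * (‖c‖ + s₀) ^ n := by simp only [hC]; ring

/-! ### Beraha–Kahane–Weiss zeros at a modulus tie of the two dominant eigenvalues -/

/-- **Zeros of `ϰ ↦ ⟨w(ϰ), T(ϰ)ⁿ v(ϰ)⟩` accumulate at a tie of two dominant simple eigenvalues.**
Let `T` be holomorphic on an open `U ∋ ϰ₀` with the two-circle separation of
`exists_two_dominant_eigenvalues_asymptotics` (rest of `σ(T(ϰ₀))` inside `C(c, s₀)`, one simple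
eigenvalue `μ₀` with eigenvector `x₀` in the annulus, one simple eigenvalue `μ₁` with eigenvector `x₁`
outside `C(c, s₁)`), and suppose: the two eigenvalues TIE in modulus and dominate the rest,
`‖μ₁‖ = ‖μ₀‖ > ‖c‖ + s₀`; the amplitudes of the holomorphic data `v(ϰ) ∈ X`, `w(ϰ) ∈ X*` at `ϰ₀`
do not vanish, `⟨w(ϰ₀), Π_j(ϰ₀) v(ϰ₀)⟩ ≠ 0`; and the ratio of the two eigenvalue branches is not
locally constant (stated for arbitrary local branches `T(ϰ)Π_j(ϰ) = λ_j(ϰ)Π_j(ϰ)`, which are unique).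
Then for some ball `B ∋ ϰ₀` and all large `n` the function `ϰ ↦ ⟨w(ϰ), T(ϰ)ⁿ v(ϰ)⟩` has a zero in
`B` — the Beraha–Kahane–Weiss theorem (non-degenerate two-dominant-eigenvalue case) for transfer
operators: partition-function zeros accumulate on the equimodular locus.
[cite: BerahaKahaneWeiss1975, Theorem (non-degenerate two-term case)] -/
theorem exists_zero_of_tied_dominant_eigenvalues {T : ℂ → E →L[ℂ] E} {U : Set ℂ}
    (hU : IsOpen U) (hT : DifferentiableOn ℂ T U) {a₀ : ℂ} (ha₀ : a₀ ∈ U) {c : ℂ} {s₀ s₁ : ℝ}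
    (hs₀ : 0 < s₀) (h01 : s₀ < s₁) (hS₀ : sphere c s₀ ⊆ resolventSet ℂ (T a₀))
    (hS₁ : sphere c s₁ ⊆ resolventSet ℂ (T a₀))
    (h0 : Module.finrank ℂ (LinearMap.range
      ((rieszProjection (T a₀) c s₁ - rieszProjection (T a₀) c s₀ : E →L[ℂ] E) : E →ₗ[ℂ] E)) = 1)
    (h1 : Module.finrank ℂ (LinearMap.range
      ((1 - rieszProjection (T a₀) c s₁ : E →L[ℂ] E) : E →ₗ[ℂ] E)) = 1)
    {w : ℂ → E →L[ℂ] ℂ} {v : ℂ → E} (hw : DifferentiableOn ℂ w U) (hv : DifferentiableOn ℂ v U)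
    {μ₀ μ₁ : ℂ} {x₀ x₁ : E} (hx₀ : T a₀ x₀ = μ₀ • x₀) (hx₀0 : x₀ ≠ 0)
    (hμ₀ : μ₀ ∉ closedBall c s₀) (hμ₀' : μ₀ ∈ ball c s₁) (hx₁ : T a₀ x₁ = μ₁ • x₁) (hx₁0 : x₁ ≠ 0)
    (hμ₁ : μ₁ ∉ closedBall c s₁) (htie : ‖μ₁‖ = ‖μ₀‖) (hdom : ‖c‖ + s₀ < ‖μ₀‖)
    (hamp₀ : w a₀ ((rieszProjection (T a₀) c s₁ - rieszProjection (T a₀) c s₀) (v a₀)) ≠ 0)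
    (hamp₁ : w a₀ ((1 - rieszProjection (T a₀) c s₁) (v a₀)) ≠ 0)
    (hnc : ∀ (lam₀ lam₁ : ℂ → ℂ) (ε : ℝ), 0 < ε →
      (∀ a ∈ ball a₀ ε, T a * (rieszProjection (T a) c s₁ - rieszProjection (T a) c s₀) =
          lam₀ a • (rieszProjection (T a) c s₁ - rieszProjection (T a) c s₀) ∧
        T a * (1 - rieszProjection (T a) c s₁) = lam₁ a • (1 - rieszProjection (T a) c s₁)) →
      ∃ a ∈ ball a₀ ε, lam₁ a / lam₀ a ≠ lam₁ a₀ / lam₀ a₀) :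
    ∃ ε : ℝ, 0 < ε ∧ ball a₀ ε ⊆ U ∧ ∃ n₀ : ℕ, ∀ n : ℕ, n₀ ≤ n →
      ∃ a ∈ ball a₀ ε, w a ((T a ^ n) (v a)) = 0 := by
  obtain ⟨ε₁, hε₁, hballU, lam₀, lam₁, c₀, c₁, C, hC, hlam₀d, hlam₁d, hc₀d, hc₁d, hbr, happ⟩ :=
    exists_twoLevel_expansion hU hT ha₀ hs₀ h01 hS₀ hS₁ h0 h1 hw hv
  have ha₀b : a₀ ∈ ball a₀ ε₁ := mem_ball_self hε₁
  -- identification of the branches and amplitudes at `a₀`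
  obtain ⟨-, -, hl₀, hl₁, hc₀a₀, hc₁a₀⟩ := hbr a₀ ha₀b
  have hQx₀ : (rieszProjection (T a₀) c s₁ - rieszProjection (T a₀) c s₀) x₀ = x₀ :=
    sub_rieszProjection_apply_of_mem_annulus hx₀ hs₀.le hμ₀ hμ₀' hS₀ hS₁
  have hRx₁ : (1 - rieszProjection (T a₀) c s₁) x₁ = x₁ :=
    one_sub_rieszProjection_apply_of_not_mem_closedBall hx₁ (hs₀.trans h01).le hμ₁ hS₁
  have hlam₀a₀ : lam₀ a₀ = μ₀ := eq_of_mul_eq_smul_of_apply_eq_self hx₀ hx₀0 hQx₀ hl₀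
  have hlam₁a₀ : lam₁ a₀ = μ₁ := eq_of_mul_eq_smul_of_apply_eq_self hx₁ hx₁0 hRx₁ hl₁
  have hc₀0 : c₀ a₀ ≠ 0 := by rw [hc₀a₀]; exact hamp₀
  have hc₁0 : c₁ a₀ ≠ 0 := by rw [hc₁a₀]; exact hamp₁
  -- the rate `q < 1` and a ball where `‖c‖ + s₀ ≤ q ‖λ₀(a)‖`
  have hμ₀pos : 0 < ‖μ₀‖ := lt_of_le_of_lt (by positivity) hdom
  have hcs : 0 < ‖c‖ + s₀ := by positivity
  set q : ℝ := ((‖c‖ + s₀) / ‖μ₀‖ + 1) / 2 with hq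
  have hratio : (‖c‖ + s₀) / ‖μ₀‖ < 1 := (div_lt_one hμ₀pos).2 hdom
  have hq0 : 0 ≤ q := by positivity
  have hqpos : 0 < q := by positivity
  have hq1 : q < 1 := by rw [hq]; linarith
  have hqr : (‖c‖ + s₀) / ‖μ₀‖ < q := by rw [hq]; linarith
  -- `t = (‖c‖ + s₀)/q < ‖μ₀‖`
  have ht : (‖c‖ + s₀) / q < ‖μ₀‖ := by
    rw [div_lt_iff₀ hqpos]
    have := (div_lt_iff₀ hμ₀pos).1 hqr
    linarith
  have hlamc : ContinuousAt lam₀ a₀ :=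
    (hlam₀d.differentiableAt (isOpen_ball.mem_nhds ha₀b)).continuousAt
  have hev : ∀ᶠ a in 𝓝 a₀, (‖c‖ + s₀) / q < ‖lam₀ a‖ := by
    have h : Tendsto (fun x => ‖lam₀ x‖) (𝓝 a₀) (𝓝 ‖μ₀‖) := by
      rw [← hlam₀a₀]
      exact hlamc.norm.tendsto
    exact h.eventually (Ioi_mem_nhds ht)
  obtain ⟨ε₂, hε₂, hball₂⟩ := Metric.eventually_nhds_iff_ball.1 hev
  set ε := min ε₁ ε₂ with hε
  have hεpos : 0 < ε := lt_min hε₁ hε₂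
  have hb₁ : ball a₀ ε ⊆ ball a₀ ε₁ := ball_subset_ball (min_le_left _ _)
  have hb₂ : ball a₀ ε ⊆ ball a₀ ε₂ := ball_subset_ball (min_le_right _ _)
  have hlow : ∀ a ∈ ball a₀ ε, ‖c‖ + s₀ ≤ q * ‖lam₀ a‖ := fun a ha => by
    have h := hball₂ a (hb₂ ha)
    rw [div_lt_iff₀ hqpos] at h
    linarith
  have hlam0 : ∀ a ∈ ball a₀ ε, lam₀ a ≠ 0 := fun a ha => by
    have h := hball₂ a (hb₂ ha)
    have hpos : 0 < ‖lam₀ a‖ := lt_trans (div_pos hcs hqpos) h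
    exact norm_pos_iff.1 hpos
  -- the data of the zero lemma on `ball a₀ ε`
  set Z : ℕ → ℂ → ℂ := fun n a => w a ((T a ^ n) (v a)) with hZ
  have hTU : DifferentiableOn ℂ T (ball a₀ ε) := hT.mono (hb₁.trans hballU)
  have hZd : ∀ n, DifferentiableOn ℂ (Z n) (ball a₀ ε) := fun n =>
    (hw.mono (hb₁.trans hballU)).clm_apply ((hTU.pow n).clm_apply (hv.mono (hb₁.trans hballU)))
  have htie' : ‖lam₁ a₀‖ = ‖lam₀ a₀‖ := by rw [hlam₀a₀, hlam₁a₀, htie]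
  have hnc' : ∃ a ∈ ball a₀ ε, lam₁ a / lam₀ a ≠ lam₁ a₀ / lam₀ a₀ :=
    hnc lam₀ lam₁ ε hεpos fun a ha => ⟨(hbr a (hb₁ ha)).2.2.1, (hbr a (hb₁ ha)).2.2.2.1⟩
  have happrox : ∃ M₁ : ℕ, ∀ M : ℕ, M₁ ≤ M → ∀ a ∈ ball a₀ ε,
      ‖Z M a - c₀ a * lam₀ a ^ M - c₁ a * lam₁ a ^ M‖ ≤ C * q ^ M * ‖lam₀ a‖ ^ M := by
    refine ⟨0, fun M _ a ha => ?_⟩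
    calc ‖Z M a - c₀ a * lam₀ a ^ M - c₁ a * lam₁ a ^ M‖ ≤ C * (‖c‖ + s₀) ^ M := happ a (hb₁ ha) M
      _ ≤ C * (q * ‖lam₀ a‖) ^ M := by
          gcongr
          exact hlow a ha
      _ = C * q ^ M * ‖lam₀ a‖ ^ M := by rw [mul_pow]; ring
  obtain ⟨M₀, hM₀⟩ := Literature.Analysis.Complex.exists_zero_of_two_dominant_eigenvalues lam₀ lam₁
    c₀ c₁ Z a₀ hεpos hq0 hq1 (hlam₀d.mono hb₁) (hlam₁d.mono hb₁) hlam0 htie' hnc' (hc₀d.mono hb₁)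
    (hc₁d.mono hb₁) hc₀0 hc₁0 hZd happrox
  exact ⟨ε, hεpos, hb₁.trans hballU, M₀, fun n hn => hM₀ n hn⟩

end Operator

end Literature.Analysis.OperatorTheory
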